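import Summits.RiemannHypothesis.RiemannHypothesis.Theorems.PfPersistenceCentralMassFloor
import HarnessLib

/-!
# Collar (edge-locality) bound for windowed lag correlations (pub-rhpf THEORY-4 §3.2/§4(b); mechanism search — no RH claims)

PROVED (kernel) form of the "edge locality" inequality behind the depth law of THEORY-4 (fake-seat
rule §4(b)(i)): on the window `[-L/2, L/2]` the lag-`y` correlation
`A_f(y) = ∫_{-L/2}^{L/2-y} f(x) f(x+y) dx` only sees the two COLLARS of width `w` once `y ≥ L - w`:

* `sq_integral_mul_le` / `abs_integral_mul_le` : Cauchy–Schwarz for interval integrals of continuous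
  functions (discriminant proof, self-contained);
* `abs_crossLagIntegral_le_collar` / `abs_lagIntegral_le_collar` :
  `|∫ g(x) h(x+y)| ≤ ‖g‖_{L²[-L/2,-L/2+w]} · ‖h‖_{L²[L/2-w,L/2]}` for `L - w ≤ y ≤ L` (cross and `g = h = f`);
* `abs_crossLagIntegral_le_collar_of_even` : even `g, h` ⇒ both factors are RIGHT-collar energies
  (the off-diagonal frame-functional budget `|(V_Dᵀ δQ V_D)_{jk}| ≤ M √(E_w(u_j) E_w(u_k))`);
* `abs_lagIntegral_le_collar_of_even` : for even `f` the bound is the single collar energy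
  `∫_{L/2-w}^{L/2} f²`;
* `abs_sum_lagIntegral_le` : a finite perturbation supported at lags in `[L-w, L]` with weights `δᵢ`
  moves `Σ δᵢ A_f(yᵢ)` by at most `(Σ |δᵢ|) · ∫_{L/2-w}^{L/2} f²`;
* `abs_lagIntegral_profile_le_collar` / `abs_crossLagIntegral_profile_le_collar` : the instances for
  the cell's Galerkin profiles `θ_v = profile L v` (even, continuous).

Everything is elementary real analysis ([folklore]); nothing here is a statement about ζ.
Decls live in the sub-namespace `…PfPersistence.CollarBound`.
-/

set_option linter.dupNamespace false  -- the mandated namespace repeats `RiemannHypothesis`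

noncomputable section

open Real MeasureTheory intervalIntegral

namespace Summit.RiemannHypothesis.RiemannHypothesis.Theorems.PfPersistence.CollarBound

open Summit.RiemannHypothesis.RiemannHypothesis.Theorems.PfPersistence

/-- PROVED (Cauchy–Schwarz, squared form): for continuous `g, h` and `a ≤ b`,
`(∫_a^b g h)² ≤ (∫_a^b g²)(∫_a^b h²)`. [folklore] -/
theorem sq_integral_mul_le {a b : ℝ} (hab : a ≤ b) {g h : ℝ → ℝ} (hg : Continuous g)
    (hh : Continuous h) :
    (∫ x in a..b, g x * h x) ^ 2 ≤ (∫ x in a..b, g x ^ 2) * (∫ x in a..b, h x ^ 2) := by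
  set A := ∫ x in a..b, g x ^ 2 with hA
  set B := ∫ x in a..b, g x * h x with hB
  set C := ∫ x in a..b, h x ^ 2 with hC
  -- `0 ≤ ∫ (t g − h)² = A t² − 2B t + C` for every real `t`
  have key : ∀ t : ℝ, 0 ≤ A * (t * t) + (-2 * B) * t + C := by
    intro t
    have hexp : ∫ x in a..b, (t * g x - h x) ^ 2 = A * (t * t) + (-2 * B) * t + C := by
      have h1 : (fun x => (t * g x - h x) ^ 2)
          = fun x => t ^ 2 * g x ^ 2 - 2 * t * (g x * h x) + h x ^ 2 := by
        funext x; ring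
      have hI1 : IntervalIntegrable (fun x => t ^ 2 * g x ^ 2) volume a b :=
        (by fun_prop : Continuous fun x => t ^ 2 * g x ^ 2).intervalIntegrable _ _
      have hI2 : IntervalIntegrable (fun x => 2 * t * (g x * h x)) volume a b :=
        (by fun_prop : Continuous fun x => 2 * t * (g x * h x)).intervalIntegrable _ _
      have hI3 : IntervalIntegrable (fun x => h x ^ 2) volume a b :=
        (by fun_prop : Continuous fun x => h x ^ 2).intervalIntegrable _ _
      rw [h1, intervalIntegral.integral_add (hI1.sub hI2) hI3, intervalIntegral.integral_sub hI1 hI2,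
        intervalIntegral.integral_const_mul, intervalIntegral.integral_const_mul, hA, hB, hC]
      ring
    rw [← hexp]
    exact integral_nonneg hab fun x _ => sq_nonneg _
  have hdisc := discrim_le_zero key
  unfold discrim at hdisc
  nlinarith [hdisc]

/-- PROVED (Cauchy–Schwarz): `|∫_a^b g h| ≤ √(∫_a^b g²) · √(∫_a^b h²)` for continuous `g, h`,
`a ≤ b`. [folklore] -/
theorem abs_integral_mul_le {a b : ℝ} (hab : a ≤ b) {g h : ℝ → ℝ} (hg : Continuous g)
    (hh : Continuous h) :
    |∫ x in a..b, g x * h x| ≤ Real.sqrt (∫ x in a..b, g x ^ 2) * Real.sqrt (∫ x in a..b, h x ^ 2) := by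
  have hA : 0 ≤ ∫ x in a..b, g x ^ 2 := integral_nonneg hab fun x _ => sq_nonneg _
  rw [← Real.sqrt_mul hA]
  exact Real.abs_le_sqrt (sq_integral_mul_le hab hg hh)

/-- PROVED (**cross collar bound**): for continuous `g, h` and a lag `y ∈ [L - w, L]`,
`|∫_{-L/2}^{L/2-y} g(x) h(x+y) dx| ≤ √(∫_{-L/2}^{-L/2+w} g²) · √(∫_{L/2-w}^{L/2} h²)`:
a lag-`y` cross-correlation at lags within `w` of the window length only sees `g` on the LEFT collar and
`h` on the RIGHT collar of width `w` (the off-diagonal entries of a frame functional). [folklore] -/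
theorem abs_crossLagIntegral_le_collar {L w y : ℝ} (hy : L - w ≤ y) (hyL : y ≤ L) {g h : ℝ → ℝ}
    (hg : Continuous g) (hh : Continuous h) :
    |∫ x in (-(L / 2))..(L / 2 - y), g x * h (x + y)|
      ≤ Real.sqrt (∫ x in (-(L / 2))..(-(L / 2) + w), g x ^ 2)
        * Real.sqrt (∫ x in (L / 2 - w)..(L / 2), h x ^ 2) := by
  have hab : -(L / 2) ≤ L / 2 - y := by linarith
  have hcs := abs_integral_mul_le hab hg (by fun_prop : Continuous fun x => h (x + y))
  -- shift the second factor: `∫_{-L/2}^{L/2-y} h(x+y)² dx = ∫_{-L/2+y}^{L/2} h²`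
  have hshift : ∫ x in (-(L / 2))..(L / 2 - y), h (x + y) ^ 2 = ∫ x in (-(L / 2) + y)..(L / 2), h x ^ 2 := by
    rw [intervalIntegral.integral_comp_add_right (fun x => h x ^ 2) y]
    congr 1; ring
  rw [hshift] at hcs
  -- enlarge both ranges to the collars (integrands `g², h² ≥ 0`)
  have hmono1 : ∫ x in (-(L / 2))..(L / 2 - y), g x ^ 2 ≤ ∫ x in (-(L / 2))..(-(L / 2) + w), g x ^ 2 :=
    integral_mono_interval le_rfl hab (by linarith)
      (Filter.Eventually.of_forall fun x => sq_nonneg _)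
      ((by fun_prop : Continuous fun x => g x ^ 2).intervalIntegrable _ _)
  have hmono2 : ∫ x in (-(L / 2) + y)..(L / 2), h x ^ 2 ≤ ∫ x in (L / 2 - w)..(L / 2), h x ^ 2 :=
    integral_mono_interval (by linarith) (by linarith) le_rfl
      (Filter.Eventually.of_forall fun x => sq_nonneg _)
      ((by fun_prop : Continuous fun x => h x ^ 2).intervalIntegrable _ _)
  calc |∫ x in (-(L / 2))..(L / 2 - y), g x * h (x + y)|
      ≤ Real.sqrt (∫ x in (-(L / 2))..(L / 2 - y), g x ^ 2)
          * Real.sqrt (∫ x in (-(L / 2) + y)..(L / 2), h x ^ 2) := hcs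
    _ ≤ Real.sqrt (∫ x in (-(L / 2))..(-(L / 2) + w), g x ^ 2)
          * Real.sqrt (∫ x in (L / 2 - w)..(L / 2), h x ^ 2) :=
        mul_le_mul (Real.sqrt_le_sqrt hmono1) (Real.sqrt_le_sqrt hmono2) (Real.sqrt_nonneg _)
          (Real.sqrt_nonneg _)

/-- PROVED (**collar bound**): for continuous `f` and a lag `y ∈ [L - w, L]`,
`|∫_{-L/2}^{L/2-y} f(x) f(x+y) dx| ≤ √(∫_{-L/2}^{-L/2+w} f²) · √(∫_{L/2-w}^{L/2} f²)`:
the lag correlation at lags within `w` of the window length only sees the two edge collars of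
width `w`. [folklore] -/
theorem abs_lagIntegral_le_collar {L w y : ℝ} (hy : L - w ≤ y) (hyL : y ≤ L) {f : ℝ → ℝ}
    (hf : Continuous f) :
    |∫ x in (-(L / 2))..(L / 2 - y), f x * f (x + y)|
      ≤ Real.sqrt (∫ x in (-(L / 2))..(-(L / 2) + w), f x ^ 2)
        * Real.sqrt (∫ x in (L / 2 - w)..(L / 2), f x ^ 2) :=
  abs_crossLagIntegral_le_collar hy hyL hf hf

/-- PROVED: an even continuous function has equal left and right collar energies:
`∫_{-L/2}^{-L/2+w} g² = ∫_{L/2-w}^{L/2} g²`. [folklore] -/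
theorem integral_sq_leftCollar_eq_of_even {L w : ℝ} {g : ℝ → ℝ} (heven : ∀ x, g (-x) = g x) :
    ∫ x in (-(L / 2))..(-(L / 2) + w), g x ^ 2 = ∫ x in (L / 2 - w)..(L / 2), g x ^ 2 := by
  have h2 : ∫ x in (-(L / 2))..(-(L / 2) + w), g (-x) ^ 2 = ∫ x in (-(-(L / 2) + w))..(-(-(L / 2))), g x ^ 2 :=
    intervalIntegral.integral_comp_neg (fun u => g u ^ 2)
  simp only [heven] at h2
  rw [h2]
  congr 1 <;> ring

/-- PROVED (**cross collar bound, even case**): for EVEN continuous `g, h` and `y ∈ [L - w, L]`,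
`|∫_{-L/2}^{L/2-y} g(x) h(x+y) dx| ≤ √(∫_{L/2-w}^{L/2} g²) · √(∫_{L/2-w}^{L/2} h²)` — the bound behind
the frame-functional budget `|(V_Dᵀ δQ V_D)_{jk}| ≤ M √(E_w(u_j) E_w(u_k))`. [folklore] -/
theorem abs_crossLagIntegral_le_collar_of_even {L w y : ℝ} (hy : L - w ≤ y) (hyL : y ≤ L)
    {g h : ℝ → ℝ} (hg : Continuous g) (hh : Continuous h) (hgeven : ∀ x, g (-x) = g x) :
    |∫ x in (-(L / 2))..(L / 2 - y), g x * h (x + y)|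
      ≤ Real.sqrt (∫ x in (L / 2 - w)..(L / 2), g x ^ 2)
        * Real.sqrt (∫ x in (L / 2 - w)..(L / 2), h x ^ 2) := by
  have h1 := abs_crossLagIntegral_le_collar hy hyL hg hh
  rwa [integral_sq_leftCollar_eq_of_even hgeven] at h1

/-- PROVED: for an EVEN continuous `f` the two collar energies coincide, so
`|∫_{-L/2}^{L/2-y} f(x) f(x+y) dx| ≤ ∫_{L/2-w}^{L/2} f²` for `y ∈ [L - w, L]`. [folklore] -/
theorem abs_lagIntegral_le_collar_of_even {L w y : ℝ} (hw0 : 0 ≤ w) (hy : L - w ≤ y) (hyL : y ≤ L)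
    {f : ℝ → ℝ} (hf : Continuous f) (heven : ∀ x, f (-x) = f x) :
    |∫ x in (-(L / 2))..(L / 2 - y), f x * f (x + y)| ≤ ∫ x in (L / 2 - w)..(L / 2), f x ^ 2 := by
  have h := abs_crossLagIntegral_le_collar_of_even hy hyL hf hf heven
  rw [← pow_two, Real.sq_sqrt] at h
  · exact h
  · exact integral_nonneg (by linarith) fun x _ => sq_nonneg _

/-- PROVED (finite perturbations in the collar): if every lag `y i` (`i ∈ s`) lies in `[L - w, L]`,
then `|Σ_{i∈s} δ i · ∫_{-L/2}^{L/2-y i} f(x) f(x + y i) dx| ≤ (Σ_{i∈s} |δ i|) · ∫_{L/2-w}^{L/2} f²`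
for even continuous `f`. [folklore] -/
theorem abs_sum_lagIntegral_le {ι : Type*} (s : Finset ι) {L w : ℝ} (hw0 : 0 ≤ w)
    (y δ : ι → ℝ) (hy : ∀ i ∈ s, L - w ≤ y i ∧ y i ≤ L) {f : ℝ → ℝ} (hf : Continuous f)
    (heven : ∀ x, f (-x) = f x) :
    |∑ i ∈ s, δ i * ∫ x in (-(L / 2))..(L / 2 - y i), f x * f (x + y i)|
      ≤ (∑ i ∈ s, |δ i|) * ∫ x in (L / 2 - w)..(L / 2), f x ^ 2 := by
  calc |∑ i ∈ s, δ i * ∫ x in (-(L / 2))..(L / 2 - y i), f x * f (x + y i)|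
      ≤ ∑ i ∈ s, |δ i * ∫ x in (-(L / 2))..(L / 2 - y i), f x * f (x + y i)| :=
        Finset.abs_sum_le_sum_abs _ _
    _ ≤ ∑ i ∈ s, |δ i| * ∫ x in (L / 2 - w)..(L / 2), f x ^ 2 := by
        apply Finset.sum_le_sum
        intro i hi
        rw [abs_mul]
        exact mul_le_mul_of_nonneg_left
          (abs_lagIntegral_le_collar_of_even hw0 (hy i hi).1 (hy i hi).2 hf heven) (abs_nonneg _)
    _ = (∑ i ∈ s, |δ i|) * ∫ x in (L / 2 - w)..(L / 2), f x ^ 2 := by rw [Finset.sum_mul]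

/-- PROVED: Connes' even modes are even functions of `x`. [folklore] -/
theorem xiEven_neg_arg (L : ℝ) (n : ℕ) (x : ℝ) : xiEven L n (-x) = xiEven L n x := by
  by_cases hn : n = 0
  · simp [xiEven, hn]
  · simp only [xiEven, hn, if_false]
    rw [show 2 * π * (n : ℝ) * -x / L = -(2 * π * n * x / L) by ring, Real.cos_neg]

/-- PROVED: Galerkin profiles are even functions of `x`. [folklore] -/
theorem profile_neg_arg (L : ℝ) {N : ℕ} (v : Fin (N + 1) → ℝ) (x : ℝ) :
    profile L v (-x) = profile L v x := by
  simp only [profile, xiEven_neg_arg]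

/-- PROVED (**collar bound for Galerkin profiles**, the cell's instance): for `θ_v = profile L v`,
`0 ≤ w` and a lag `y ∈ [L - w, L]`,
`|∫_{-L/2}^{L/2-y} θ_v(x) θ_v(x+y) dx| ≤ ∫_{L/2-w}^{L/2} θ_v²` — a prime-side perturbation supported at
lags `log n ≥ L - w` sees only the edge-collar energy of the state. [folklore] -/
theorem abs_lagIntegral_profile_le_collar {L w y : ℝ} (hw0 : 0 ≤ w) (hy : L - w ≤ y) (hyL : y ≤ L)
    {N : ℕ} (v : Fin (N + 1) → ℝ) :
    |∫ x in (-(L / 2))..(L / 2 - y), profile L v x * profile L v (x + y)|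
      ≤ ∫ x in (L / 2 - w)..(L / 2), profile L v x ^ 2 :=
  abs_lagIntegral_le_collar_of_even hw0 hy hyL (CentralMassFloor.continuous_profile L v)
    (profile_neg_arg L v)

/-- PROVED (**cross collar bound for two Galerkin profiles**): for `θ_v, θ_{v'}` and a lag
`y ∈ [L - w, L]`, `|∫_{-L/2}^{L/2-y} θ_v(x) θ_{v'}(x+y) dx| ≤ √(∫_{L/2-w}^{L/2} θ_v²) · √(∫_{L/2-w}^{L/2} θ_{v'}²)`
— the off-diagonal entries of a depth-`D` frame functional see a collar-supported perturbation only
through the collar energies of the frame vectors. [folklore] -/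
theorem abs_crossLagIntegral_profile_le_collar {L w y : ℝ} (hy : L - w ≤ y) (hyL : y ≤ L) {N : ℕ}
    (v v' : Fin (N + 1) → ℝ) :
    |∫ x in (-(L / 2))..(L / 2 - y), profile L v x * profile L v' (x + y)|
      ≤ Real.sqrt (∫ x in (L / 2 - w)..(L / 2), profile L v x ^ 2)
        * Real.sqrt (∫ x in (L / 2 - w)..(L / 2), profile L v' x ^ 2) :=
  abs_crossLagIntegral_le_collar_of_even hy hyL (CentralMassFloor.continuous_profile L v)
    (CentralMassFloor.continuous_profile L v') (profile_neg_arg L v)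

end Summit.RiemannHypothesis.RiemannHypothesis.Theorems.PfPersistence.CollarBound

end
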